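import Summits.BirchSwinnertonDyer.BirchSwinnertonDyer.Theorems.AdditiveBranchIMCMultLowerTameRoadsMultClosedSeventeen
import Literature.NumberTheory.EllipticCurves.HeegnerPointsOfConductorRationalityBirchProofs
import HarnessLib

/-!
# Line `tame_roads_mult` (crux `MultLower`, stmt-BirchSwinnertonDyer-19359) — the (M) road sub-row from SIXTEEN printed theorems + `hAFC`

Sequel of `AdditiveBranchIMCMultLowerTameRoadsMultClosedSeventeen.lean` (p727769, LEAD g8). Of its seventeen named printed hypotheses,
ONE MORE IS NOW A THEOREM OF THE TREE: the Birch-keyed CM rationality of the Heegner points of conductor `n`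
(`phi_heegnerPointOfConductor_mem_range_map_ringClassField_birch`, Darmon 2004 Thm. 3.6 at `τ = x(n)` under `4N ∣ β² − d_K`; conjunct (G1)
of the genus Kolyvagin system over the `p`-ramified field `K″`) is DISCHARGED by
`forall_phi_heegnerPointOfConductor_mem_range_map_ringClassField_birch` (`Literature/…/HeegnerPointsOfConductorRationalityBirchProofs.lean`,
p730874, LEAD g9). So the (M) road sub-row in analytic rank `≤ 1` (cell (M), `TameRoadRow`, `r_an = 1 ∨ p ∤ ∏ c_ℓ`) has
`ord_p #Ш(E)_an ≤ ord_p #Ш(E)` GIVEN SIXTEEN printed theorems and the research statement `hAFC` (= the registered stub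
`stub_tameAwayFromCycM`'s conclusion). THEOREMS ONLY; BSD is proved for no curve by this file; crux 19359 stays OPEN.
-/

noncomputable section

set_option linter.dupNamespace false

namespace Summit.BirchSwinnertonDyer.BirchSwinnertonDyer.Theorems.TameRoadsMultClosedSixteen

open scoped Classical

open NumberField IsDedekindDomain
open WeierstrassCurve Literature.NumberTheory.EllipticCurves
  Literature.NumberTheory.EllipticCurves.ModularForms
  Literature.NumberTheory.EllipticCurves.Rank1Residual
  Literature.NumberTheory.EllipticCurves.Rank1Residual.Typed

open Summit.BirchSwinnertonDyer.Rank1Residual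
open Summit.BirchSwinnertonDyer.Rank1Residual.Additive
open Summit.BirchSwinnertonDyer.BirchSwinnertonDyer.Theorems
open Field Literature.NumberTheory.EllipticCurves.ModularForms
open ThreeFieldRoadSupply

/-- **THE (M) ROAD SUB-ROW FROM SIXTEEN PRINTED THEOREMS AND THE RESEARCH STATEMENT.** Of the seventeen named printed hypotheses of
`TameRoadsMultClosedSeventeen.missingLowerBoundAt_of_roadRowM_seventeenFacts`, the Birch-keyed CM rationality
`phi_heegnerPointOfConductor_mem_range_map_ringClassField_birch` (Darmon 2004 Thm. 3.6 at `x(n)`) is a THEOREM OF THE TREE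
(`forall_phi_heegnerPointOfConductor_mem_range_map_ringClassField_birch`). So the (M) road sub-row in analytic rank `≤ 1` has
`ord_p #Ш(E)_an ≤ ord_p #Ш(E)` GIVEN SIXTEEN printed theorems and `hAFC`.
[cite: Darmon2004, Thm. 3.6 (PDF pp. 43–44)] [cite: Skinner2016PacificMC, Thm. C] [cite: JetchevSkinnerWan2017, §7.4.1] -/
theorem missingLowerBoundAt_of_roadRowM_sixteenFacts (hDel : Delbourgo1998.prop4_rankZero_pow_dvd_constantCoeff)
    (hGZK : rank_eq_analyticRank_of_analyticRank_le_one) (hmodP : nonempty_modularParametrizationData)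
    (hKato : Wuthrich2014.kato_halfEigenCharIdeal_dvd_cyclotomicPrime_of_surjective)
    (hF5 : friedbergHoffstein_exists_twist_ne_zero_ramifiedAt_splitAt)
    (hF6 : friedbergHoffstein_exists_twist_simpleZero_ramifiedAt_splitAt)
    (hGZ73 : GrossZagier1986_thm_I_7_3) (hSk : Skinner2016.thmC_padicValRat_bsd_rank_zero)
    (hCST : CaiShuTian2014.thm11_trivialChar) (hCSTrc : CaiShuTian2014.thm11_ringClassChar)
    (hMaz : mazur_not_dvd_maninConstant_of_odd)
    (hB : Hsieh2014.thmB_exists_isHsiehLFunction_coeff_norm_eq_one_unrPeriod_ramifiedSteinberg)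
    (hLZZ : LiuZhangZhang2018.thm151_thm153_modularCurve_heegnerVector_additive_ramifiedSteinberg)
    (hHL : HoffsteinLuo1997_exists_twist_L_one_ne_zero)
    (hNek : Nekovar2007.cmPoint_frobeniusCongruence)
    (hP53 : ∀ (N : ℕ) [NeZero N] (W : WeierstrassCurve ℚ) (K : Type) [Field K] [NumberField K],
      GrossLMS1991.prop53_conj_pinned_birch N W K)
    (hAFC : ∀ (W : WeierstrassCurve ℚ) [W.IsElliptic] [W.IsGloballyMinimal] (p : ℕ) [Fact p.Prime]
      (K : Type) [Field K] [NumberField K],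
      W.analyticRank ≤ 1 → N10.CellM W p → TameRoadRow W p → TameRoadField W p K →
      ∀ (N : ℕ) [NeZero N] (Dt : ModularParametrizationData W N), W.conductorNorm ℤ = N →
      ∀ (κ : ZpExtension K p), κ.IsAnticyclotomic → ∀ (γ : Field.absoluteGaloisGroup K) [Fact (κ.IsTopGenerator γ)]
        (𝔭 : HeightOneSpectrum (𝓞 K)), ((p : ℕ) : 𝓞 K) ∈ 𝔭.asIdeal → 𝔭.asIdeal.ramificationIdx (𝓞 ℚ) = 1 →
        𝔭.asIdeal.inertiaDeg (𝓞 ℚ) = 1 → ∀ (𝔭' : HeightOneSpectrum (𝓞 K)), ((p : ℕ) : 𝓞 K) ∈ 𝔭'.asIdeal → 𝔭' ≠ 𝔭 →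
        ∀ (ι' : PadicAlgCl p ≃+* ℂ), SchneiderFree.BranchInducesPrime p ι' 𝔭 →
          Module.IsTorsion (IwasawaAlgebra p) (X11b.AcSelmer.XAc (W.baseChange K) p κ 𝔭' ∅ γ) →
          ∀ (κ₁ : ZpExtension K p) (γ₁ : Field.absoluteGaloisGroup K) [Fact (ZpExtension.IsTopGeneratorPair κ₁ κ γ₁ γ)],
            ∃ (A B : PowerSeries (PowerSeries (PadicComplexInt p))) (h : PowerSeries (PadicComplexInt p))
              (ΩK' : ℂ) (Ωp' : ℂ_[p]) (Q' D : PowerSeries (PadicComplexInt p)),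
              h ≠ 0 ∧ ΩK' ≠ 0 ∧ Ωp' ≠ 0 ∧ X11b.R1.IsBDPLFunctionInt p ι' 𝔭 κ γ Dt.f ΩK' Ωp' Q' ∧
              (∀ y ∈ (WeierstrassCurve.XGr₂.charIdeal (W.baseChange K) p κ₁ κ 𝔭' γ₁ γ).map
                  (IwasawaAlgebra₂.toUnr₂ p (X11b.R1.toCpInt p)),
                PowerSeries.map (PowerSeries.C : PadicComplexInt p →+* PowerSeries (PadicComplexInt p)) h * B * y ∈
                  Ideal.span {A}) ∧
              PowerSeries.constantCoeff B ≠ 0 ∧ PowerSeries.constantCoeff A = PowerSeries.constantCoeff B * D ∧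
              D ≠ 0 ∧ Ideal.span {D} ≤ Ideal.span {Q'})
    (W : WeierstrassCurve ℚ) [W.IsElliptic] [W.IsGloballyMinimal] (p : ℕ) [Fact p.Prime]
    (hr : W.analyticRank ≤ 1) (hcell : N10.CellM W p) (hrow : TameRoadRow W p)
    (htame : W.analyticRank = 1 ∨ ¬ p ∣ W.tamagawaProduct) :
    MissingLowerBoundAt W p :=
  TameRoadsMultClosedSeventeen.missingLowerBoundAt_of_roadRowM_seventeenFacts hDel hGZK hmodP hKato hF5 hF6 hGZ73 hSk hCST hCSTrc
    hMaz hB hLZZ hHL forall_phi_heegnerPointOfConductor_mem_range_map_ringClassField_birch hNek hP53 hAFC W p hr hcell hrow htame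

end Summit.BirchSwinnertonDyer.BirchSwinnertonDyer.Theorems.TameRoadsMultClosedSixteen

end
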